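import Summits.BirchSwinnertonDyer.Rank1Residual.Supersingular.DescentLowerBound
import Summits.BirchSwinnertonDyer.Rank1Residual.Supersingular.X6RankOneOneSided
import Literature.NumberTheory.EllipticCurves.BSDRankZeroDensityProofs
import HarnessLib

/-!
# Supersingular family, analytic rank `≤ 1`: the typed LOWER half from the cardinality form of the
# native `p`-descent certificate, `p^{r+1} ∣ #Sel^(p)(E/ℚ)` — class X6 in BOTH ranks (cell `b2b-bsdres`,
# supersingular family, prover A = unit `b2b-bsdres-x10b`, gen 5)

HONEST FRAMING (run/shared/lean/b2b/bsd-rank1-residual/, verbatim in every file): the goal of the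
cell is to DELETE the COMBINATION-SHAPED residual classes of the Birch–Swinnerton-Dyer formula for
ALL analytic-rank `≤ 1` elliptic curves over `ℚ` — "full BSD formula for every rank `≤ 1` curve in
class `C`" assembled STRICTLY from published theorems — so that the rank-`≤ 1` remainder becomes
exactly the CONSTRUCTION-SHAPED classes, which are TYPED (missing-input `Prop`s), NOT attempted.
This is not "finishing BSD". X6 stays CONSTRUCTION-SHAPED; nothing is booked here; PER-PAIR
certificate consumers only, every input a PUBLISHED theorem taken by name plus one finite certificate
line per curve.

Theorems only (no definition, no named fact). Companion of `Supersingular/DescentLowerBound.lean`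
(p212413; rank `0`, certificate line `Sel^(p)(E/ℚ) ≠ 0`). Here the certificate is the CARDINALITY
line an exact `p`-descent prints, `p ^ (rank + 1) ∣ #Sel^(p)(E/ℚ)` (i.e. `dim_𝔽_p Sel^(p) ≥ rank + 1`),
which also serves analytic rank `1`:
* `natCard_torsionBy_eq_one_of_not_dvd_torsionOrder` — `p ∤ #E(K)_tors ⇒ #E(K)[p] = 1` (any number field);
* `exists_sha_torsion_of_pow_succ_dvd_card_selmerGroup` — `p ∤ #E(K)_tors` and
  `p^{rank_ℤ E(K) + 1} ∣ #Sel^(p)(E/K)` ⇒ `Ш(E/K)[p] ≠ 0`: by Mordell–Weil and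
  `#(E(K)/pE(K)) = p^{rank}·#E(K)[p]` (`natCard_quotient_range_zsmul`, PROVED) the Kummer image has
  order `p^{rank}`; if `Ш[p]` were `0` the PROVED fundamental sequence (`selmer_exact_holds`) would give
  `Sel^(p) = im κ` of order `p^{rank}`, contradicting the certificate;
* `missingLowerBoundAt_of_casselsTate_of_pow_succ_dvd_card_selmerGroup` — over `ℚ`, `r_an ≤ 1`
  (GZK: `rank = r_an`, `Ш` finite), `ord_p #Ш_an ≤ 2` ⇒ `MissingLowerBoundAt W p` (Cassels–Tate);
* `X6.bsdp_of_casselsTate_of_pow_succ_dvd_card_selmerGroup` — X6, odd `p`, `r_an ≤ 1`: `BSD(E,p)` from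
  PUBLISHED theorems (Sprung 2024 Cor. 1.3 (ii) `hS` for the rank-`1` upper half [flags
  `Sprung24-Cor13-via-Kob13` / `KOB13-primary-unread` as in `X6RankOneOneSided.lean`], Wuthrich 2014
  Prop. 21 `hW` for rank `0`, Cassels–Tate `hCT`, GZK, modularity) + the certificate. Census use:
  harvest-1's 42 X6-shaped rank-`1` pairs with `3 ∣ #Ш_an` (`N < 5·10⁵`, all `p = 3`, `#Ш_an = 9`,
  none below `2·10⁴`; `HOME/b2b-bsdres-harvest-1/g18/x6r1/`): each needs `dim Sel₃ = 3` on two engines.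

References: [SilvermanAEC2009] Thm. VIII.6.7, X.4.2, X.4.14; [Sprung2024] Cor. 1.3; [Wuthrich2014]
Prop. 21; [Miller2011LMS] Def. 1.1; Schaefer–Stoll 2004.
-/

noncomputable section

open scoped Classical AddSubgroup

open WeierstrassCurve Literature.NumberTheory.EllipticCurves
  Literature.NumberTheory.EllipticCurves.Rank1Residual
  Literature.NumberTheory.EllipticCurves.Rank1Residual.Typed
  Literature.NumberTheory.EllipticCurves.Wuthrich2014

namespace Summit.BirchSwinnertonDyer.Rank1Residual.Supersingular

section General

variable {K : Type*} [Field K] [NumberField K] (W : WeierstrassCurve K) [W.IsElliptic]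

omit [NumberField K] [W.IsElliptic] in
/-- `p ∤ #E(K)_tors ⇒ E(K)[p] = 0`, so `#E(K)[p] = 1` (a point of order `p` would be a torsion point
of order dividing `#E(K)_tors`). [cite: SilvermanAEC2009, Thm VIII.6.7] -/
theorem natCard_torsionBy_eq_one_of_not_dvd_torsionOrder (p : ℕ) [hp : Fact p.Prime]
    (htors : ¬ p ∣ W.torsionOrder) : Nat.card (W.toAffine.Point[(p : ℤ)]) = 1 := by
  have hbot : W.toAffine.Point[(p : ℤ)] = ⊥ := by
    rw [eq_bot_iff]
    intro P hP
    rw [AddSubgroup.mem_bot]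
    by_contra hP0
    have hpP : p • P = 0 := AddSubgroup.torsionBy.nsmul_iff.mp hP
    have hord : addOrderOf P = p := addOrderOf_eq_prime hpP hP0
    have hfin : IsOfFinAddOrder P := by
      rw [← addOrderOf_pos_iff, hord]; exact hp.out.pos
    have hmemT : P ∈ AddCommGroup.torsion W.toAffine.Point := by
      rw [AddCommGroup.mem_torsion]; exact hfin
    have hordT : addOrderOf (⟨P, hmemT⟩ : AddCommGroup.torsion W.toAffine.Point) = p := by
      rw [← AddSubgroup.addOrderOf_coe]; exact hord
    apply htors
    have := addOrderOf_dvd_natCard (⟨P, hmemT⟩ : AddCommGroup.torsion W.toAffine.Point)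
    rw [hordT] at this
    exact this
  rw [hbot]
  exact AddSubgroup.card_bot

/-- **General-rank native certificate, LOWER direction: `p^{rank + 1} ∣ #Sel^(p)(E/K)` forces
`Ш(E/K)[p] ≠ 0`** (no point datum; `p ∤ #E(K)_tors`; `#` is `Nat.card`). By
Mordell–Weil, `#(E(K)/pE(K)) = p^{rank}·#E(K)[p] = p^{rank}` (`natCard_quotient_range_zsmul`,
PROVED), which is the order of the Kummer image `im κ ≤ Sel^(p)` in the PROVED fundamental sequence
(`selmer_exact_holds`); if `Ш(E/K)[p]`, the image of `Sel^(p)` in `H¹(K,E)`, were zero, then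
`Sel^(p) = im κ` would have order `p^{rank}`, which `p^{rank+1}` does not divide.
[cite: SilvermanAEC2009, Thm X.4.2(a)] -/
theorem exists_sha_torsion_of_pow_succ_dvd_card_selmerGroup (p : ℕ) [hp : Fact p.Prime]
    (htors : ¬ p ∣ W.torsionOrder)
    (hcard : p ^ (W.mordellWeilRank + 1) ∣ Nat.card (W.selmerGroup (p : ℤ))) :
    ∃ x : W.sha, x ≠ 0 ∧ p • x = 0 := by
  have hp0 : (p : ℤ) ≠ 0 := by exact_mod_cast hp.out.ne_zero
  obtain ⟨κ, hker, hrange, hmap⟩ := selmer_exact_holds W (p : ℤ) hp0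
  haveI : Module.Finite ℤ W.toAffine.Point := W.module_finite_point_holds
  -- `#(im κ) = #(E(K)/pE(K)) = p ^ rank`
  have hcardR : Nat.card κ.range = p ^ W.mordellWeilRank := by
    have hq := natCard_quotient_range_zsmul W hp.out.ne_zero (n := p)
    rw [natCard_torsionBy_eq_one_of_not_dvd_torsionOrder W p htors, mul_one] at hq
    rw [← hq, ← hker]
    exact (Nat.card_congr (QuotientAddGroup.quotientKerEquivRange κ).toEquiv).symm
  by_contra hnone
  push Not at hnone
  -- then `Ш ⊓ H¹(K,E)[p] = ⊥`
  have hbot : W.sha ⊓ W.galH1[(p : ℤ)] = ⊥ := by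
    rw [eq_bot_iff]
    intro y hy
    rw [AddSubgroup.mem_bot]
    by_contra hy0
    have hne' : (⟨y, hy.1⟩ : W.sha) ≠ 0 := fun h => hy0 (congrArg Subtype.val h)
    apply hnone ⟨y, hy.1⟩ hne'
    apply Subtype.ext
    simpa only [AddSubgroupClass.coe_nsmul, ZeroMemClass.coe_zero] using
      AddSubgroup.torsionBy.nsmul_iff.mp hy.2
  -- so `Sel^(p) ≤ ker`, `Sel^(p) = im κ`, `#Sel^(p) = p ^ rank`
  have hSelker : W.selmerGroup (p : ℤ) ≤ (W.torsionH1ToH1 (p : ℤ)).ker := by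
    rw [← AddSubgroup.map_eq_bot_iff, hmap, hbot]
  have heq : κ.range = W.selmerGroup (p : ℤ) := by
    rw [hrange]; exact inf_eq_left.mpr hSelker
  have hSel : Nat.card (W.selmerGroup (p : ℤ)) = p ^ W.mordellWeilRank := by rw [← heq, hcardR]
  rw [hSel] at hcard
  have := (Nat.pow_dvd_pow_iff_le_right hp.out.one_lt).mp hcard
  omega

end General

section OverQ

variable (W : WeierstrassCurve ℚ) [W.IsElliptic] (p : ℕ) [Fact p.Prime]

/-- **The typed LOWER half from the cardinality certificate, analytic rank `≤ 1`, class-free.** At a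
pair with `ord_{s=1} L(E,s) ≤ 1`, `#Ш(E/ℚ)_an = q` with `ord_p q ≤ 2`, `p ∤ #E(ℚ)_tors` and `p^{r_an + 1} ∣ #Sel^(p)(E/ℚ)`:
`MissingLowerBoundAt W p`. GZK (`hGZK`) gives
`rank = r_an` and `Ш` finite; `exists_sha_torsion_of_pow_succ_dvd_card_selmerGroup` gives `p ∣ #Ш`;
Cassels–Tate squareness (`hCT`) gives `p² ∣ #Ш`. [cite: SilvermanAEC2009, Thm. X.4.14] [cite: Miller2011LMS, Def. 1.1] -/
theorem missingLowerBoundAt_of_casselsTate_of_pow_succ_dvd_card_selmerGroup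
    (hCT : exists_casselsTate_pairing (K := ℚ))
    (hGZK : rank_eq_analyticRank_of_analyticRank_le_one) (hr : W.analyticRank ≤ 1)
    (htors : ¬ p ∣ W.torsionOrder) {q : ℚ} (hq : shaAn W = (q : ℂ)) (hv : padicValRat p q ≤ 2)
    (hcard : p ^ (W.analyticRank + 1) ∣ Nat.card (W.selmerGroup (p : ℤ))) :
    MissingLowerBoundAt W p := by
  have hrank : W.mordellWeilRank = W.analyticRank := (hGZK W hr).1
  have hex : ∃ x : W.sha, x ≠ 0 ∧ p • x = 0 :=
    exists_sha_torsion_of_pow_succ_dvd_card_selmerGroup W p htors (by rw [hrank]; exact hcard)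
  exact missingLowerBoundAt_of_casselsTate_of_pow_dvd W p hCT (hGZK W hr).2 hq
    (k := 1) (by simpa using hv) (by simpa using dvd_shaOrder_of_exists_torsion W p hex)

variable [W.IsGloballyMinimal]

/-- **X6, odd `p`, analytic rank `≤ 1`, `ord_p #Ш_an ≤ 2`: `BSD(E,p)` from PUBLISHED theorems + the
cardinality certificate `p^{r_an+1} ∣ #Sel^(p)(E/ℚ)`** (`dim_𝔽_p Sel^(p) ≥ r_an + 1`, from an exact
`p`-descent on two engines). Inputs by name: Sprung 2024 Cor. 1.3 (ii) (`hS`, the rank-`1` upper half;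
REFEREED, flags `Sprung24-Cor13-via-Kob13` / `KOB13-primary-unread` carried as in
`X6RankOneOneSided.lean`), Wuthrich 2014 Prop. 21 (`hW`, rank `0`), Cassels–Tate (`hCT`), GZK
(`hGZK`), modularity (`hmod`); `p ∤ #E(ℚ)_tors` from `ClassX6.irr`; consumer
`X6.bsdp_of_missingLowerBoundAt` (harvest-1, p209700). Census use: the 42 X6-shaped rank-`1` pairs with
`3 ∣ #Ш_an` of `HOME/b2b-bsdres-harvest-1/g18/x6r1/` (`N < 5·10⁵`; none below `2·10⁴`), certificate
`dim Sel₃ = 3`. Per-pair; NOT a class theorem. [cite: Sprung2024, Cor. 1.3] [cite: Wuthrich2014, Prop. 21 (p. 400)]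
[cite: SilvermanAEC2009, Thm. X.4.14] [cite: Serre1972, §1.11 Prop. 12] [cite: Miller2011LMS, §1 and Def. 1.1] -/
theorem X6.bsdp_of_casselsTate_of_pow_succ_dvd_card_selmerGroup
    (hS : Sprung2024.cor13_padicValRat_bsd_rank_one_le) (hW : sha_dvd_analyticSha)
    (hCT : exists_casselsTate_pairing (K := ℚ))
    (hGZK : rank_eq_analyticRank_of_analyticRank_le_one) (hmod : hasEntireLFunction_rat)
    (hp : p ≠ 2) (hX : ClassX6 W p) (hr : W.analyticRank ≤ 1)
    {q : ℚ} (hq : shaAn W = (q : ℂ)) (hv : padicValRat p q ≤ 2)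
    (hcard : p ^ (W.analyticRank + 1) ∣ Nat.card (W.selmerGroup (p : ℤ))) : BSDp W p :=
  X6.bsdp_of_missingLowerBoundAt W p hS hW hGZK hmod hp hX hr
    (missingLowerBoundAt_of_casselsTate_of_pow_succ_dvd_card_selmerGroup W p hCT hGZK hr
      (not_dvd_torsionOrder_of_irr W p (ClassX6.irr W p hp hX)) hq hv hcard)

end OverQ

end Summit.BirchSwinnertonDyer.Rank1Residual.Supersingular

end
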